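import Literature.NumberTheory.DiophantineGeometry.AbcWave0
import HarnessLib

/-!
# Product of the exponents of an abc triple (Pasten's Shimura-curve bound)

Topic `NumberTheory/DiophantineGeometry`; namespace `Literature.Abc` (abc triples, `rad` as in
`AbcWave0`).

H. Pasten, *Shimura curves and the abc conjecture*, J. Number Theory 254 (2024), 214–335
(arXiv:1705.09251), Theorem 1.10 = Theorem 16.8 of the journal version ("Product of valuations
for abc triples"), restated as Theorem 2.5 of Pasten, Invent. Math. 236 (2024):

> **Theorem 2.5** (Bound for ABC triples, Theorem 16.8 in [PastenShimura]). Let `ε > 0`. There is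
> a number `κ_ε` depending only on `ε` such that the following holds: For all coprime positive
> integers `a, b, c` with `a + b = c` we have `∏_{p ∣ abc} ν_p(abc) ≤ κ_ε · rad(abc)^{8/3 + ε}`.

It is proved with the author's theory of Shimura-curve parametrisations of (Frey–Hellegouarch)
elliptic curves (modularity, Jacquet–Langlands, a Ribet–Takahashi formula, Arakelov-theoretic
lower bounds for Petersson norms via Yuan–Zhang); none of this is in Mathlib, so the result is
vendored as a named fact. For comparison, linear forms in `p`-adic logarithms bound the MAXIMUM
`max_{p ∣ abc} ν_p(abc) ≪_ε rad(abc)^{1/3+ε}` (Stewart–Yu 2001), not the product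
[cite: Pasten2024, §2.3].

## The divisor-function form

In [PastenShimura2024, Theorem 16.8] the theorem is printed for the number of divisors,
`d(abc) < K_ε · rad(abc)^{8/3+ε}`, with the product of valuations as its "in particular"
clause. Since `∏ ν_p ≤ ∏ (ν_p + 1) = d ≤ 2^{ω} ∏ ν_p` and `2^{ω(abc)} ≪_δ rad(abc)^δ`, the two
forms are equivalent; this is proved here (`pasten2024_thm_2_5_iff_card_divisors_lt`), so that
either form can be fed to users of the named fact.

The printed proof (§16.4 of the paper) combines Proposition 15.1 and Lemma 15.2 (linear forms in
`p`-adic logarithms) with Theorem 16.4 (ii) (the Shimura-curve estimate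
`∏_{p ∣ D} v_p(Δ_E) < N_E^{8/3+ε} M` for Frey–Hellegouarch curves; arXiv numbering); the latter
rests on modularity, Jacquet–Langlands, a Ribet–Takahashi formula and Arakelov-theoretic bounds,
none of which is available, so `pasten2024_thm_2_5` stays a named fact here.

## References

* [Pasten2024] H. Pasten, *The largest prime factor of `n² + 1` and improvements on subexponential
  ABC*, Invent. Math. 236 (2024), 373–385, doi:10.1007/s00222-024-01244-6 — Theorem 2.5.
* [PastenShimura2024] H. Pasten, *Shimura curves and the abc conjecture*, J. Number Theory 254
  (2024), 214–335, doi:10.1016/j.jnt.2023.07.002, arXiv:1705.09251 — Theorem 1.10 / 16.8.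
-/

noncomputable section

namespace Literature.NumberTheory.DiophantineGeometry

/-- The product `∏_{p ∣ n} ν_p(n)` of the exponents in the prime factorisation of `n`
(`= 1` for `n ≤ 1`, empty product). [cite: Pasten2024, Theorem 2.5] -/
def exponentProduct (n : ℕ) : ℕ :=
  ∏ p ∈ n.primeFactors, n.factorization p

/-- Unfolding lemma for `exponentProduct`. [folklore] -/
theorem exponentProduct_def (n : ℕ) :
    exponentProduct n = ∏ p ∈ n.primeFactors, n.factorization p :=
  rfl

/-- Sanity check: `∏_{p ∣ 72} ν_p(72) = 3 · 2 = 6` (`72 = 2³ · 3²`). [folklore] -/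
theorem exponentProduct_seventyTwo : exponentProduct 72 = 6 := by
  rw [exponentProduct_def, show (72 : ℕ) = 2 ^ 3 * 3 ^ 2 by norm_num,
    Nat.primeFactors_mul (by norm_num) (by norm_num),
    Nat.primeFactors_prime_pow (by norm_num) Nat.prime_two,
    Nat.primeFactors_prime_pow (by norm_num) Nat.prime_three,
    Nat.factorization_mul (by norm_num) (by norm_num), Nat.factorization_pow, Nat.factorization_pow,
    Nat.Prime.factorization Nat.prime_two, Nat.Prime.factorization Nat.prime_three]
  simp [Finsupp.single_apply]

/-- **Pasten, Theorem 2.5** (= *Shimura curves and the abc conjecture*, J. Number Theory 254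
(2024), Theorem 16.8 / arXiv Thm 1.10). For every `ε > 0` there is `κ_ε` such that every abc
triple satisfies `∏_{p ∣ abc} ν_p(abc) ≤ κ_ε · rad(abc)^{8/3 + ε}` (`Real.rpow`).
[cite: Pasten2024, Theorem 2.5] [cite: PastenShimura2024, Theorem 16.8] -/
def pasten2024_thm_2_5 : Prop :=
  ∀ ε : ℝ, 0 < ε → ∃ κ : ℝ, ∀ a b c : ℕ, IsABCTriple a b c →
    (exponentProduct (a * b * c) : ℝ) ≤ κ * (rad a b c : ℝ) ^ (8 / 3 + ε : ℝ)

/-! ### The divisor-function form (Theorem 16.8 of the Shimura-curve paper, main display) -/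

/-- `∏_{p ∣ n} ν_p(n) ≤ ∏_{p ∣ n} (ν_p(n) + 1) = d(n)` for `n ≠ 0`. [folklore] -/
theorem exponentProduct_le_card_divisors {n : ℕ} (hn : n ≠ 0) :
    exponentProduct n ≤ n.divisors.card := by
  rw [exponentProduct_def, Nat.card_divisors hn]
  exact Finset.prod_le_prod (fun _ _ => Nat.zero_le _) fun _ _ => Nat.le_succ _

/-- `d(n) = ∏_{p ∣ n} (ν_p(n) + 1) ≤ ∏_{p ∣ n} 2 ν_p(n) = 2^{ω(n)} ∏_{p ∣ n} ν_p(n)` for `n ≠ 0`.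
[folklore] -/
theorem card_divisors_le_two_pow_mul_exponentProduct {n : ℕ} (hn : n ≠ 0) :
    n.divisors.card ≤ 2 ^ n.primeFactors.card * exponentProduct n := by
  rw [exponentProduct_def, Nat.card_divisors hn, ← Finset.prod_const, ← Finset.prod_mul_distrib]
  refine Finset.prod_le_prod (fun _ _ => Nat.zero_le _) fun p hp => ?_
  have h1 : 1 ≤ n.factorization p := by
    rw [Nat.succ_le_iff, pos_iff_ne_zero, ← Finsupp.mem_support_iff,
      Nat.support_factorization]
    exact hp
  omega

/-- The product of an abc triple is nonzero. [folklore] -/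
theorem IsABCTriple.mul_ne_zero {a b c : ℕ} (h : IsABCTriple a b c) : a * b * c ≠ 0 := by
  obtain ⟨ha, hb, habc, -⟩ := h
  have hc : 0 < c := by omega
  positivity

/-- `rad(abc) = ∏_{p ∣ abc} p`, cast to `ℝ`. [folklore] -/
theorem cast_rad_eq_prod (a b c : ℕ) :
    (rad a b c : ℝ) = ∏ p ∈ (a * b * c).primeFactors, (p : ℝ) := by
  rw [rad_def, Nat.radical_eq_prod_primeFactors, Nat.cast_prod]

/-- `0 < rad(abc)` (in `ℝ`). [folklore] -/
theorem cast_rad_pos (a b c : ℕ) : (0 : ℝ) < (rad a b c : ℝ) := by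
  rw [rad_def]
  exact_mod_cast Nat.radical_pos _

/-- **Divisor-bound input for squarefree kernels:** for every `δ > 0` there is `C > 0` with
`2^{ω(n)} ≤ C · (∏_{p ∣ n} p)^δ` for all `n` (primes `p ≥ 2^{1/δ}` contribute `p^δ ≥ 2` each,
the others at most `2^{⌈2^{1/δ}⌉}` in total). [folklore] -/
theorem exists_two_pow_card_primeFactors_le (δ : ℝ) (hδ : 0 < δ) :
    ∃ C : ℝ, 0 < C ∧ ∀ n : ℕ,
      (2 : ℝ) ^ n.primeFactors.card ≤ C * (∏ p ∈ n.primeFactors, (p : ℝ)) ^ δ := by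
  obtain ⟨T, hT⟩ : ∃ T : ℕ, ∀ p : ℕ, T ≤ p → (2 : ℝ) ≤ (p : ℝ) ^ δ := by
    refine ⟨⌈(2 : ℝ) ^ (1 / δ)⌉₊, fun p hp => ?_⟩
    have h1 : (2 : ℝ) ^ (1 / δ) ≤ p := (Nat.le_ceil _).trans (by exact_mod_cast hp)
    calc (2 : ℝ) = ((2 : ℝ) ^ (1 / δ)) ^ δ := by
          rw [← Real.rpow_mul (by norm_num), one_div_mul_cancel hδ.ne', Real.rpow_one]
      _ ≤ (p : ℝ) ^ δ := Real.rpow_le_rpow (by positivity) h1 hδ.le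
  refine ⟨2 ^ T, by positivity, fun n => ?_⟩
  set P := n.primeFactors with hP
  have hsplit : (P.filter (· < T)).card + (P.filter (fun p => ¬ p < T)).card = P.card :=
    Finset.card_filter_add_card_filter_not _
  have hS : (P.filter (· < T)).card ≤ T := by
    calc (P.filter (· < T)).card ≤ (Finset.range T).card :=
          Finset.card_le_card fun p hp => by
            rw [Finset.mem_filter] at hp
            exact Finset.mem_range.2 hp.2
      _ = T := Finset.card_range T
  have hL : (2 : ℝ) ^ (P.filter (fun p => ¬ p < T)).card ≤ (∏ p ∈ P, (p : ℝ)) ^ δ := by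
    rw [← Real.finsetProd_rpow _ _ (fun p _ => by positivity)]
    calc (2 : ℝ) ^ (P.filter (fun p => ¬ p < T)).card
          = ∏ _p ∈ P.filter (fun p => ¬ p < T), (2 : ℝ) := by rw [Finset.prod_const]
      _ ≤ ∏ p ∈ P.filter (fun p => ¬ p < T), (p : ℝ) ^ δ :=
          Finset.prod_le_prod (fun _ _ => by norm_num) fun p hp => by
            rw [Finset.mem_filter, not_lt] at hp
            exact hT p hp.2
      _ ≤ ∏ p ∈ P, (p : ℝ) ^ δ :=
          Finset.prod_le_prod_of_subset_of_one_le (Finset.filter_subset _ _)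
            (fun _ _ => by positivity) fun p hp _ =>
              Real.one_le_rpow (by exact_mod_cast (Nat.prime_of_mem_primeFactors hp).one_le)
                hδ.le
  calc (2 : ℝ) ^ P.card
        = 2 ^ (P.filter (· < T)).card * 2 ^ (P.filter (fun p => ¬ p < T)).card := by
          rw [← pow_add, hsplit]
    _ ≤ 2 ^ T * (∏ p ∈ P, (p : ℝ)) ^ δ :=
          mul_le_mul (pow_le_pow_right₀ (by norm_num) hS) hL (by positivity) (by positivity)

/-- **Theorem 16.8 (divisor form) ⟹ Theorem 2.5**: `∏ ν_p(abc) ≤ d(abc)`.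
[cite: PastenShimura2024, Theorem 16.8] -/
theorem pasten2024_thm_2_5_of_card_divisors_lt
    (h : ∀ ε : ℝ, 0 < ε → ∃ K : ℝ, 0 < K ∧ ∀ a b c : ℕ, IsABCTriple a b c →
      ((a * b * c).divisors.card : ℝ) < K * (rad a b c : ℝ) ^ (8 / 3 + ε : ℝ)) :
    pasten2024_thm_2_5 := by
  intro ε hε
  obtain ⟨K, -, hK⟩ := h ε hε
  refine ⟨K, fun a b c habc => ?_⟩
  have h1 : (exponentProduct (a * b * c) : ℝ) ≤ ((a * b * c).divisors.card : ℝ) := by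
    exact_mod_cast exponentProduct_le_card_divisors habc.mul_ne_zero
  exact h1.trans (hK a b c habc).le

/-- **Theorem 2.5 ⟹ Theorem 16.8 (divisor form)**: `d(abc) ≤ 2^{ω(abc)} ∏ ν_p(abc)` and
`2^{ω(abc)} ≪_δ rad(abc)^δ`; this is the statement of [PastenShimura2024, Theorem 16.8] as
printed (`d(abc) < K_ε · rad(abc)^{8/3+ε}` with `K_ε > 0`), obtained from the named fact.
[cite: PastenShimura2024, Theorem 16.8] -/
theorem pasten2024_thm_2_5.card_divisors_lt (h : pasten2024_thm_2_5) :
    ∀ ε : ℝ, 0 < ε → ∃ K : ℝ, 0 < K ∧ ∀ a b c : ℕ, IsABCTriple a b c →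
      ((a * b * c).divisors.card : ℝ) < K * (rad a b c : ℝ) ^ (8 / 3 + ε : ℝ) := by
  intro ε hε
  obtain ⟨κ, hκ⟩ := h (ε / 2) (by positivity)
  obtain ⟨C, hC, hCω⟩ := exists_two_pow_card_primeFactors_le (ε / 2) (by positivity)
  refine ⟨C * max κ 1 + 1, by positivity, fun a b c habc => ?_⟩
  have h0 := habc.mul_ne_zero
  have hR := cast_rad_pos a b c
  set R : ℝ := (rad a b c : ℝ)
  have hω : (2 : ℝ) ^ (a * b * c).primeFactors.card ≤ C * R ^ (ε / 2) := by
    have := hCω (a * b * c)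
    rwa [← cast_rad_eq_prod] at this
  have hprod : (exponentProduct (a * b * c) : ℝ) ≤ max κ 1 * R ^ (8 / 3 + ε / 2 : ℝ) :=
    (hκ a b c habc).trans (mul_le_mul_of_nonneg_right (le_max_left _ _) (by positivity))
  have hd : ((a * b * c).divisors.card : ℝ)
      ≤ (2 : ℝ) ^ (a * b * c).primeFactors.card * (exponentProduct (a * b * c) : ℝ) := by
    exact_mod_cast card_divisors_le_two_pow_mul_exponentProduct h0
  have hexp : R ^ (ε / 2) * R ^ (8 / 3 + ε / 2 : ℝ) = R ^ (8 / 3 + ε : ℝ) := by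
    rw [← Real.rpow_add hR]
    ring_nf
  calc ((a * b * c).divisors.card : ℝ)
        ≤ (2 : ℝ) ^ (a * b * c).primeFactors.card * (exponentProduct (a * b * c) : ℝ) := hd
    _ ≤ (C * R ^ (ε / 2)) * (max κ 1 * R ^ (8 / 3 + ε / 2 : ℝ)) :=
          mul_le_mul hω hprod (by positivity) (by positivity)
    _ = C * max κ 1 * R ^ (8 / 3 + ε : ℝ) := by rw [← hexp]; ring
    _ < (C * max κ 1 + 1) * R ^ (8 / 3 + ε : ℝ) := by
          have : (0 : ℝ) < R ^ (8 / 3 + ε : ℝ) := by positivity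
          nlinarith

/-- The product-of-valuations form (Theorem 2.5 of [Pasten2024]) and the divisor-function form
(Theorem 16.8 of [PastenShimura2024] as printed) are equivalent.
[cite: PastenShimura2024, Theorem 16.8] -/
theorem pasten2024_thm_2_5_iff_card_divisors_lt :
    pasten2024_thm_2_5 ↔
      ∀ ε : ℝ, 0 < ε → ∃ K : ℝ, 0 < K ∧ ∀ a b c : ℕ, IsABCTriple a b c →
        ((a * b * c).divisors.card : ℝ) < K * (rad a b c : ℝ) ^ (8 / 3 + ε : ℝ) :=
  ⟨pasten2024_thm_2_5.card_divisors_lt, pasten2024_thm_2_5_of_card_divisors_lt⟩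

end Literature.NumberTheory.DiophantineGeometry

end
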